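import Summits.QuantumFields.YangMills.Theorems.BalabanUVNodesN15TwoSpacingGluingNeumannDefectClosed
import HarnessLib

/-!
# THE GLUING STEP AT TWO LATTICE SPACINGS, XXXIX: THE FINE-SPACING ROWS OF THE LIFTED NEUMANN CUBES AND THE REMAINDER ROWS OF THE COVER ON THE TORUS OF RECORD AT BOTH
# SPACINGS, `O(L^{−s})`, CONSTANTS FREE OF THE VOLUME (dag-n15-c g13, FILE 81; N15 = NE2, s1 «background-layer OPERATOR ingredient»)

Cell `pub-ymgap`, seat `pub-ymgap-dag-n15-c` (R134 (a); HUMAN RULING D-0062), generation 13.  `bears_on: R4∕N15 · K3⁷ SpineGivenEndpointR13SepCoPH (stmt-QuantumFields-20544)`.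
Filed `--supports stmt-QuantumFields-20544 --as helper` — COUNT-NEUTRAL.  Theorems only (0 `def`, 0 `sorry`).  Imports BY NAME FILE 80 (through it FILES 69, 72, 73 and dag-n15-a's
PROGRAMMES N ∕ P); nothing in the tree is modified.  These are the INPUT ROWS of the record-torus two-grid defect knit (next file, FILE 82) — split out so that each heavy
assembly elaborates in its own declaration.

WHAT.  Torus of record `M = MP (paramsOf d L m_T K hL)` (`M_ν = 2L^{m_T}`, `m_T` FREE), FILE 73's cover (cubes `□_k` of side `L^{s+1}`, lifted Neumann propagators `knitGR` =
dag-n15-a `liftCubeG`, partition `knitHR`), coarse spacing `L^{−K}`, fine spacing `L^{−(K+r)}`.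
* §1 ★★ `liftCubeG_grad_row_fine` (`χ_□ ∘ ∇′_ν ∘ G′^{↑}(□ + c) ≤ 1_□1_□βe^{−δd}` at `L^r·L^K`: N `hasMaj_chiCube_grad_neumannCubeG_fine` at the cube torus + P-IIc
  `mulOp_chiCube_comp_sD_comp_liftCubeG` (descent) + P `hasMaj_transplant_cube_family_spacing`), ★★ `liftCubeG_comp_row_fine`
  ((β′) at `L^r·L^K`: ANY fine big-torus operator `T₁` behind the lifted cube, output-cut — P `hasMaj_chiCube_comp_liftCubeG_of` with the cube-torus letter from `ineq110_114_pair`);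
* §2 ★★★ **`hasMaj_commOp_deltaOp_comp_knitGR_row`** (coarse) and ★★★ **`hasMaj_commOp_deltaOp_comp_knitGR_row_fine`** (fine, blocks native to `L^r·L^K`): `∃ δ, κ₀` FREE OF THE
  VOLUME, the cube exponent, the spacings and the cube index, with `[Δ_a, M_{h_k}] ∘ G^{↑}(□_k) ≤ 1_□(y′)·(κ₀∕L^s)·e^{−δ|y−y′|_T}` for `s + 1 ≤ m_T`, `K ≥ 1` — FILE 72
  `hasMaj_commOp_comp_cover_of` on P-IIb ∕ P-IId ∕ P-IIe (coarse: FILE 73's assembly verbatim, now EXPOSED as a theorem) ∕ on `hasMaj_chiCube_liftCubeG_fine`, §1,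
  `hasMaj_chiCube_divAdjOut_liftCubeG_pair` (fine), with FILE 69's nonlocal letter and FILE 72 `hasMaj_commOp_coverH`, compressed by FILE 73 `remainderConstR_le`.

HONEST FRAMING ∕ LIMITS.  Block-majorant bookkeeping over LANDED rows at `U ≡ 1` (no new analytic estimate).  Nothing of [B5]∕[B6]∕[B9] asserted: shapes (2.92)–(2.93), (2.133)–(2.135)
of [B6] only; the cubes are Neumann-by-images MODELS of [B6]'s Dirichlet cubes.  NE2⁺ NOT PRINTED, NOT proved; N15 NOT discharged; counts of record UNMOVED (typed 28∕28 · discharged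
5∕27); one finite 𝕋⁴ at fixed ε per index — NOT infinite volume, NOT OS on ℝ⁴, NOT a mass gap, NOT Clay; R4 closes the conditional finite-𝕋⁴ rung `BalabanLadder.UV` only.
Restate-immune (no Theses import).
-/

noncomputable section

namespace Summit.QuantumFields.YangMills.BalabanUVNodes.N15.Gluing

open Real
open Literature.MathematicalPhysics.QuantumFieldTheory.Balaban1983to89
open Literature.MathematicalPhysics.QuantumFieldTheory.Balaban1983to89.B5Prop11Plancherel (Tor fine)
open Literature.MathematicalPhysics.QuantumFieldTheory.Balaban1983to89.B11SectG (BlockNorm HasMaj RowSum)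
open Literature.MathematicalPhysics.QuantumFieldTheory.Balaban1983to89.B6Prop26Gluing (mulOp ind ind_nonneg ind_le_one)
open Literature.MathematicalPhysics.QuantumFieldTheory.Balaban1983to89.B6UnitTorusCarrier (unitTorusGeo triangle254_unitTorusGeo rowSum_unitTorusGeo unitTorusGeo_dist_nonneg)
open Literature.MathematicalPhysics.QuantumFieldTheory.Balaban1983to89.B5SiteBridgeP12 (MP)
open Literature.MathematicalPhysics.QuantumFieldTheory.King1986.Torus (blockOf tdistT tdistT_nonneg)
open Summit.QuantumFields.YangMills.BalabanUVNodes.N15.VectorPiece (bshiftEquiv kingPrV)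
open Summit.QuantumFields.YangMills.BalabanUVNodes.N15.BackgroundLayer (fgrad bgrad symbOp_sD_eq)
open Summit.QuantumFields.YangMills.BalabanUVNodes.N15.TwoGrid (symbOp sD sTinv paramsOf deltaOp gOp neumannCubeG chiCube cubeBlocks liftCubeG MP_dvd_MP torRed
  landauRe qvRe qvAdjRe ineq110_114_pair hasMaj_gOp_of_ineq hasMaj_landauRe hasMaj_chiCube_liftCubeG hasMaj_chiCube_liftCubeG_fine hasMaj_chiCube_grad_liftCubeG
  hasMaj_chiCube_grad_neumannCubeG_fine hasMaj_chiCube_divAdjOut_liftCubeG_pair hasMaj_chiCube_comp_liftCubeG_family hasMaj_chiCube_comp_liftCubeG_of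
  mulOp_chiCube_comp_sD_comp_liftCubeG hasMaj_transplant_cube_family_spacing)

variable {d : ℕ}

/-! ## §1 The two fine-spacing lifted rows -/

section FineRows

variable {L : ℕ} [NeZero L]

/-- ★★ **THE FINE MEMBER's ENTRY 1 ON THE TORUS OF RECORD**: `χ_□ ∘ ∇′_ν ∘ G′^{↑}(□ + c) ≤ 1_□1_□βe^{−δd}` at spacing `L^r·L^K` (blocks read through King's pairing), for every
`s ≤ m_T`, `K ≥ 1`, `r`, corner `c`, direction `ν` — PROGRAMME N's fine entry-1 row at the cube torus `2L^s`, the DESCENT of `∇_ν` and the any-spacing family transfer; constants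
uniform in the volume. [cite: Balaban1984PropagatorsII, (2.133)–(2.134) p.247 (shape), p.238 (T_□); Balaban1984PropagatorsI, Prop. 1.2 (1.110) p.35] -/
theorem liftCubeG_grad_row_fine (hL : Odd L ∧ 1 < L) {a : ℝ} (ha : 0 < a) :
    ∃ δ β : ℝ, 0 < δ ∧ 0 < β ∧ ∀ (s mT K r : ℕ) (hs : s ≤ mT) (_hK : 1 ≤ K) (c : Tor (MP (paramsOf d L mT K hL))) (ν : Fin (d + 1)),
      HasMaj (BlockNorm.ofBlocks (unitTorusGeo L K (MP (paramsOf d L mT K hL)))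
          (fun i : Tor (fine (L ^ r * L ^ K) (MP (paramsOf d L mT K hL))) × Fin (d + 1) => blockOf (L ^ r * L ^ K) (MP (paramsOf d L mT K hL)) i.1))
        (BlockNorm.ofBlocks (unitTorusGeo L K (MP (paramsOf d L mT K hL)))
          (fun i : Tor (fine (L ^ r * L ^ K) (MP (paramsOf d L mT K hL))) × Fin (d + 1) => blockOf (L ^ r * L ^ K) (MP (paramsOf d L mT K hL)) i.1))
        (mulOp (chiCube (MP (paramsOf d L mT K hL)) (L ^ r * L ^ K) c (L ^ s)) ∘ₗ
          symbOp (MP (paramsOf d L mT K hL)) (L ^ r * L ^ K) (sD (MP (paramsOf d L mT K hL)) (L ^ r * L ^ K) ν ((L ^ r * L ^ K : ℕ) : ℝ)) ∘ₗ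
          liftCubeG (L ^ r * L ^ K) (MP_dvd_MP hL hs K) c (L ^ s) a)
        (fun y y' => ind ((cubeBlocks (MP (paramsOf d L mT K hL)) c (L ^ s) : Finset _) : Set _) y *
          ind ((cubeBlocks (MP (paramsOf d L mT K hL)) c (L ^ s) : Finset _) : Set _) y' * (β * Real.exp (-(δ * tdistT (MP (paramsOf d L mT K hL)) y y')))) := by
  obtain ⟨δ, β, hδ, hβ, H⟩ := hasMaj_chiCube_grad_neumannCubeG_fine (d := d) hL ha
  refine ⟨δ, β, hδ, hβ, fun s mT K r hs hK c ν => ?_⟩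
  exact (hasMaj_transplant_cube_family_spacing hL hs (L ^ r * L ^ K) c _ hβ.le (H s K r hK (torRed (MP_dvd_MP hL hs K) c) ν)).congr fun f =>
    (LinearMap.congr_fun (mulOp_chiCube_comp_sD_comp_liftCubeG (L ^ r * L ^ K) (MP_dvd_MP hL hs K) c (L ^ s) a ν ((L ^ r * L ^ K : ℕ) : ℝ)) f).symm

/-- ★★ **(β′) AT THE FINE SPACING ON THE TORUS OF RECORD**: for odd `L ≥ 3`, `a > 0` there are `δ₀, C > 0` (part 12's, at the cube torus) such that for all `s ≤ m_T`, `K ≥ 1`,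
`r`, any corner `c`, ANY operator `T₁ ≤ a₁e^{−ρ₁|·|_T}` of the big torus at spacing `L^r·L^K` and any row sum `c_r` at rate `σ` with `ρ ≤ δ₀`, `ρ + σ ≤ ρ₁`:
`M_{χ_□} ∘ T₁ ∘ G′^{↑}(□ + c) ≤ 1_□(y)1_□(y′)·2^{d+1}a₁Ce^{δ₀}c_r·e^{−ρ|y−y′|_T}` — P `hasMaj_chiCube_comp_liftCubeG_of` with the cube-torus letter `G′ ≤ Ce^{−δ₀d′}` from
`ineq110_114_pair`; constants uniform in the volume. [cite: Balaban1984PropagatorsII, (2.37) p.229, Lemma 2.1 (2.61)–(2.62) p.234, p.238 (T_□), (2.133)–(2.134) p.247;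
Balaban1984PropagatorsI, Prop. 1.2 (1.110) p.35] -/
theorem liftCubeG_comp_row_fine (hL : Odd L ∧ 1 < L) {a : ℝ} (ha : 0 < a) :
    ∃ δ₀ C : ℝ, 0 < δ₀ ∧ 0 < C ∧ ∀ (s mT K r : ℕ) (hs : s ≤ mT) (_hK : 1 ≤ K) (c : Tor (MP (paramsOf d L mT K hL)))
      (T₁ : Module.End ℝ (Tor (fine (L ^ r * L ^ K) (MP (paramsOf d L mT K hL))) × Fin (d + 1) → ℝ)) {a₁ ρ₁ ρ σ cr : ℝ}
      (_hrow : RowSum (unitTorusGeo L K (MP (paramsOf d L mT K hL))) σ cr) (_ha₁ : 0 ≤ a₁) (_hρ : 0 ≤ ρ) (_hρδ : ρ ≤ δ₀) (_hρσ : ρ + σ ≤ ρ₁)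
      (_h₁ : HasMaj (BlockNorm.ofBlocks (unitTorusGeo L K (MP (paramsOf d L mT K hL)))
          (fun i : Tor (fine (L ^ r * L ^ K) (MP (paramsOf d L mT K hL))) × Fin (d + 1) => blockOf (L ^ r * L ^ K) (MP (paramsOf d L mT K hL)) i.1))
        (BlockNorm.ofBlocks (unitTorusGeo L K (MP (paramsOf d L mT K hL)))
          (fun i : Tor (fine (L ^ r * L ^ K) (MP (paramsOf d L mT K hL))) × Fin (d + 1) => blockOf (L ^ r * L ^ K) (MP (paramsOf d L mT K hL)) i.1)) T₁
        (fun y y' => a₁ * Real.exp (-(ρ₁ * tdistT (MP (paramsOf d L mT K hL)) y y')))),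
      HasMaj (BlockNorm.ofBlocks (unitTorusGeo L K (MP (paramsOf d L mT K hL)))
          (fun i : Tor (fine (L ^ r * L ^ K) (MP (paramsOf d L mT K hL))) × Fin (d + 1) => blockOf (L ^ r * L ^ K) (MP (paramsOf d L mT K hL)) i.1))
        (BlockNorm.ofBlocks (unitTorusGeo L K (MP (paramsOf d L mT K hL)))
          (fun i : Tor (fine (L ^ r * L ^ K) (MP (paramsOf d L mT K hL))) × Fin (d + 1) => blockOf (L ^ r * L ^ K) (MP (paramsOf d L mT K hL)) i.1))
        (mulOp (chiCube (MP (paramsOf d L mT K hL)) (L ^ r * L ^ K) c (L ^ s)) ∘ₗ T₁ ∘ₗ liftCubeG (L ^ r * L ^ K) (MP_dvd_MP hL hs K) c (L ^ s) a)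
        (fun y y' => ind ((cubeBlocks (MP (paramsOf d L mT K hL)) c (L ^ s) : Finset _) : Set _) y *
          ind ((cubeBlocks (MP (paramsOf d L mT K hL)) c (L ^ s) : Finset _) : Set _) y' *
          (2 ^ (d + 1) * (a₁ * (C * Real.exp δ₀) * cr) * Real.exp (-(ρ * tdistT (MP (paramsOf d L mT K hL)) y y')))) := by
  obtain ⟨δ₀, C, Cα, Cε, Cαε, hδ₀, hC, H⟩ := ineq110_114_pair (d := d) hL ha
  refine ⟨δ₀, C, hδ₀, hC, fun s mT K r hs hK c T₁ a₁ ρ₁ ρ σ cr hrow ha₁ hρ hρδ hρσ h₁ => ?_⟩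
  have hM' : ∀ ν, MP (paramsOf d L s K hL) ν = 2 * L ^ s := fun ν => rfl
  have hn' : 1 ≤ L ^ r * L ^ K := Nat.one_le_iff_ne_zero.mpr (Nat.mul_ne_zero (pow_ne_zero r (NeZero.ne L)) (pow_ne_zero K (NeZero.ne L)))
  have hG' : HasMaj (BlockNorm.ofBlocks (unitTorusGeo L K (MP (paramsOf d L s K hL)))
        (fun i : Tor (fine (L ^ r * L ^ K) (MP (paramsOf d L s K hL))) × Fin (d + 1) => blockOf (L ^ r * L ^ K) (MP (paramsOf d L s K hL)) i.1))
      (BlockNorm.ofBlocks (unitTorusGeo L K (MP (paramsOf d L s K hL)))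
        (fun i : Tor (fine (L ^ r * L ^ K) (MP (paramsOf d L s K hL))) × Fin (d + 1) => blockOf (L ^ r * L ^ K) (MP (paramsOf d L s K hL)) i.1))
      (gOp (MP (paramsOf d L s K hL)) (L ^ r * L ^ K) a) (fun y y' => C * Real.exp (-(δ₀ * tdistT (MP (paramsOf d L s K hL)) y y'))) :=
    hasMaj_gOp_of_ineq (L := L) (k := K) (MP (paramsOf d L s K hL)) (L ^ r * L ^ K) a hn' (H s K r hK).2 hC.le
  exact hasMaj_chiCube_comp_liftCubeG_of (L ^ r * L ^ K) (MP_dvd_MP hL hs K) c (L ^ s) hM' (triangle254_unitTorusGeo L K _) hrow hC.le hδ₀.le ha₁ hρ hρδ hρσ h₁ hG'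

end FineRows

/-! ## §2 The remainder rows of the cover at both spacings, `O(L^{−s})` -/

section RemainderRows

variable {L : ℕ} [NeZero L]

/-- ★★★ **THE REMAINDER ROW OF EACH CUBE OF THE COVER ON THE TORUS OF RECORD, COARSE SPACING**: for odd `L ≥ 3`, `a > 0` there are `δ > 0`, `κ₀ ≥ 0` — FREE OF THE VOLUME `m_T`,
the cube exponent `s`, the spacing `K` and the cube index — with `[Δ_a, M_{h_k}] ∘ G^{↑}(□_k) ≤ 1_□(y′)·(κ₀∕L^s)·e^{−δ|y−y′|_T}` for `s + 1 ≤ m_T`, `K ≥ 1` (FILE 73's assembly, exposed: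
FILE 72 `hasMaj_commOp_comp_cover_of` on P-IIb ∕ P-IId ∕ P-IIe with FILE 69's nonlocal letter, compressed by `remainderConstR_le`). [cite: Balaban1984PropagatorsII, (2.92)–(2.93)
p.239, (2.133)–(2.135) p.247 («O(M⁻¹)»: shapes + mechanism); Balaban1984PropagatorsI, (1.121)–(1.128) pp.37–38] -/
theorem hasMaj_commOp_deltaOp_comp_knitGR_row (hL : Odd L ∧ 1 < L) {a : ℝ} (ha : 0 < a) :
    ∃ δ κ₀ : ℝ, 0 < δ ∧ 0 ≤ κ₀ ∧ ∀ (s mT K : ℕ) (hs : s + 1 ≤ mT) (_hK : 1 ≤ K) (k : Fin (d + 1) → ZMod (2 * L ^ (mT - s))),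
      HasMaj (BlockNorm.ofBlocks (unitTorusGeo L K (MP (paramsOf d L mT K hL))) (fun b : Tor (fine (L ^ K) (MP (paramsOf d L mT K hL))) × Fin (d + 1) => blockOf (L ^ K) (MP (paramsOf d L mT K hL)) b.1))
        (BlockNorm.ofBlocks (unitTorusGeo L K (MP (paramsOf d L mT K hL))) (fun b : Tor (fine (L ^ K) (MP (paramsOf d L mT K hL))) × Fin (d + 1) => blockOf (L ^ K) (MP (paramsOf d L mT K hL)) b.1))
        (commOp (deltaOp (MP (paramsOf d L mT K hL)) (L ^ K) a) (knitHR d L s mT K (L ^ K) hL k) ∘ₗ knitGR d L s mT K (L ^ K) hL hs a k)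
        (fun y y' => ind ((cubeBlocks (MP (paramsOf d L mT K hL)) (coverCorner (MP (paramsOf d L mT K hL)) (L ^ s) (L ^ (mT - s)) (coverMargin L s) k) (L ^ (s + 1)) : Finset _) : Set _) y' *
          (κ₀ / ((L ^ s : ℕ) : ℝ) * Real.exp (-(δ * tdistT (MP (paramsOf d L mT K hL)) y y')))) := by
  obtain ⟨δG, βG, hδG, hβG, HG⟩ := hasMaj_chiCube_liftCubeG (d := d) hL ha
  obtain ⟨δD, βD, hδD, hβD, HD⟩ := hasMaj_chiCube_grad_liftCubeG (d := d) hL ha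
  obtain ⟨δB, βB, hδB, hβB, HB⟩ := hasMaj_chiCube_divAdjOut_liftCubeG_pair (d := d) hL ha
  obtain ⟨δ₀, C, hδ₀, hC, HC⟩ := hasMaj_chiCube_comp_liftCubeG_family (d := d) hL ha
  obtain ⟨δ₁, C₁, hδ₁, hC₁, HL⟩ := hasMaj_landauRe (d := d) (L := L)
  set δm : ℝ := min (min (min δG δD) (min δB δ₀)) δ₁ with hδm_def
  have hδm : 0 < δm := lt_min (lt_min (lt_min hδG hδD) (lt_min hδB hδ₀)) hδ₁
  have hmG : δm ≤ δG := (min_le_left _ _).trans ((min_le_left _ _).trans (min_le_left _ _))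
  have hmD : δm ≤ δD := (min_le_left _ _).trans ((min_le_left _ _).trans (min_le_right _ _))
  have hmB : δm ≤ δB := (min_le_left _ _).trans ((min_le_right _ _).trans (min_le_left _ _))
  have hm0 : δm ≤ δ₀ := (min_le_left _ _).trans ((min_le_right _ _).trans (min_le_right _ _))
  have hm1 : δm ≤ δ₁ := min_le_right _ _
  set cr : ℝ := B4Sect5Proof.latticeConst (d + 1) (δm / 4) with hcr_def
  have hcr : 0 ≤ cr := B4Sect5Proof.latticeConst_nonneg (d + 1) (by positivity)
  set β₁ : ℝ := max βD βB with hβ₁_def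
  have hβ₁ : 0 ≤ β₁ := hβD.le.trans (le_max_left _ _)
  set cN : ℝ := |a| * (Real.exp δm * Real.exp δm) + C₁ with hcN_def
  have hcN : 0 ≤ cN := by positivity
  set κ₀ : ℝ := (((d + 1 : ℕ) * (32 * π ^ 2 * βG + 2 * (π * β₁))) + 2 ^ (d + 1) * ((π * (d + 1) * (Real.exp 1 * (δm / 4))⁻¹ + 2 * (π * (d + 1))) * cN * (C * Real.exp δ₀) * cr) +
    cN * (8 / δm) * βG * cr) with hκ₀_def
  have hκ₀ : 0 ≤ κ₀ := by positivity
  have h14 : δm / 2 + δm / 4 ≤ 3 * δm / 4 := by linarith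
  have h34 : 3 * δm / 4 ≤ δm := by linarith
  have h24 : δm / 2 + δm / 4 ≤ δm - δm / 4 := by linarith
  have h20 : δm / 2 ≤ δ₀ := by linarith
  refine ⟨δm / 2, κ₀, by positivity, hκ₀, fun s mT K hs hK k => ?_⟩
  have hL3 : 3 ≤ L := by obtain ⟨⟨j, hj⟩, h1⟩ := hL; omega
  have hLpos : 0 < L := by omega
  set M : Fin (d + 1) → ℕ := MP (paramsOf d L mT K hL) with hMdef
  have hs' : s ≤ mT := by omega
  have hM : ∀ ν, M ν = 2 * L ^ (mT - s) * L ^ s := MP_eq_two_mul L s mT K hL hs'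
  have hw : 0 < L ^ s := pow_pos hLpos s
  haveI : NeZero (L ^ (mT - s)) := ⟨pow_ne_zero _ (NeZero.ne L)⟩
  have hwR : (1 : ℝ) ≤ ((L ^ s : ℕ) : ℝ) := by exact_mod_cast hw
  have hSe : L ^ (s + 1) = L * L ^ s := by rw [pow_succ, mul_comm]
  have hfit : 2 * coverMargin L s + 2 * L ^ s + 1 ≤ L ^ (s + 1) := by rw [hSe]; exact coverMargin_fit hL3 s
  have hS : L ^ (s + 1) ≤ 2 * L ^ (mT - s) * L ^ s := by
    rw [← hM 0]
    show L ^ (s + 1) ≤ 2 * L ^ mT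
    have := Nat.pow_le_pow_right hLpos hs
    omega
  have hwm : ((L ^ s : ℕ) : ℝ) ≤ 2 * ((coverMargin L s : ℝ) + 1) := by exact_mod_cast le_two_mul_coverMargin hL3 s
  have hΘ := remainderConstR_le d (β₁ := β₁) (m₀ := ((coverMargin L s : ℕ) : ℝ)) (CC := C * Real.exp δ₀) hβG.le hcN hδm hcr hwR hwm
  have hrow := rowSum_unitTorusGeo (L := L) (k := K) (M := M) (σ := δm / 4) (by positivity)
  set c : Tor M := coverCorner M (L ^ s) (L ^ (mT - s)) (coverMargin L s) k with hc_def
  have hind : ∀ y y' : Tor M, 0 ≤ ind (g := unitTorusGeo L K M) ((cubeBlocks M c (L ^ (s + 1)) : Finset (Tor M)) : Set (Tor M)) y *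
      ind (g := unitTorusGeo L K M) ((cubeBlocks M c (L ^ (s + 1)) : Finset (Tor M)) : Set (Tor M)) y' := fun y y' => mul_nonneg (ind_nonneg _ _) (ind_nonneg _ _)
  -- the nonlocal part's letter, the cut rows and the commutator half at the common rate `δm ∕ 2`
  have hN' := hasMaj_nonlocalPart (L := L) (kk := K) (M := M) (n := L ^ K) (a := a) hC₁.le hδm.le hm1 (HL K (L ^ K) M)
  have hGc : HasMaj (BlockNorm.ofBlocks (unitTorusGeo L K M) (fun b : Tor (fine (L ^ K) M) × Fin (d + 1) => blockOf (L ^ K) M b.1))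
      (BlockNorm.ofBlocks (unitTorusGeo L K M) (fun b : Tor (fine (L ^ K) M) × Fin (d + 1) => blockOf (L ^ K) M b.1))
      (mulOp (chiCube M (L ^ K) c (L ^ (s + 1))) ∘ₗ knitGR d L s mT K (L ^ K) hL hs a k)
      (fun y y' => ind ((cubeBlocks M c (L ^ (s + 1)) : Finset (Tor M)) : Set (Tor M)) y * ind ((cubeBlocks M c (L ^ (s + 1)) : Finset (Tor M)) : Set (Tor M)) y' *
        (βG * Real.exp (-(δm / 2 * tdistT M y y')))) := hasMaj_rate_le hind hβG.le (by linarith) (HG (s + 1) mT K hs hK c)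
  have hDc : ∀ μ, HasMaj (BlockNorm.ofBlocks (unitTorusGeo L K M) (fun b : Tor (fine (L ^ K) M) × Fin (d + 1) => blockOf (L ^ K) M b.1))
      (BlockNorm.ofBlocks (unitTorusGeo L K M) (fun b : Tor (fine (L ^ K) M) × Fin (d + 1) => blockOf (L ^ K) M b.1))
      (mulOp (chiCube M (L ^ K) c (L ^ (s + 1))) ∘ₗ (fgrad ((L ^ K : ℕ) : ℝ) (bshiftEquiv M (L ^ K) μ) ∘ₗ knitGR d L s mT K (L ^ K) hL hs a k))
      (fun y y' => ind ((cubeBlocks M c (L ^ (s + 1)) : Finset (Tor M)) : Set (Tor M)) y * ind ((cubeBlocks M c (L ^ (s + 1)) : Finset (Tor M)) : Set (Tor M)) y' *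
        (β₁ * Real.exp (-(δm / 2 * tdistT M y y')))) := fun μ => by
    rw [← symbOp_sD_eq]
    exact (hasMaj_rate_le hind hβD.le (by linarith : δm / 2 ≤ δD) (HD (s + 1) mT K hs hK c μ)).mono fun y y' =>
      mul_le_mul_of_nonneg_left (mul_le_mul_of_nonneg_right (le_max_left _ _) (Real.exp_nonneg _)) (hind y y')
  have hDbc : ∀ μ, HasMaj (BlockNorm.ofBlocks (unitTorusGeo L K M) (fun b : Tor (fine (L ^ K) M) × Fin (d + 1) => blockOf (L ^ K) M b.1))
      (BlockNorm.ofBlocks (unitTorusGeo L K M) (fun b : Tor (fine (L ^ K) M) × Fin (d + 1) => blockOf (L ^ K) M b.1))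
      (mulOp (chiCube M (L ^ K) c (L ^ (s + 1))) ∘ₗ (bgrad ((L ^ K : ℕ) : ℝ) (bshiftEquiv M (L ^ K) μ) ∘ₗ knitGR d L s mT K (L ^ K) hL hs a k))
      (fun y y' => ind ((cubeBlocks M c (L ^ (s + 1)) : Finset (Tor M)) : Set (Tor M)) y * ind ((cubeBlocks M c (L ^ (s + 1)) : Finset (Tor M)) : Set (Tor M)) y' *
        (β₁ * Real.exp (-(δm / 2 * tdistT M y y')))) := fun μ => by
    rw [bgrad_eq_neg_symbOp, LinearMap.neg_comp, LinearMap.comp_neg]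
    exact ((hasMaj_rate_le hind hβB.le (by linarith : δm / 2 ≤ δB) ((HB (s + 1) mT K 0 hs hK c μ).1)).mono fun y y' =>
      mul_le_mul_of_nonneg_left (mul_le_mul_of_nonneg_right (le_max_right _ _) (Real.exp_nonneg _)) (hind y y')).neg
  have hcomm := hasMaj_commOp_coverH (L := L) (kk := K) (M := M) (n := L ^ K) (w := L ^ s) (q := L ^ (mT - s)) hM hw k hcN (by positivity : 0 < δm / 4) hN'
  have hC := HC (s + 1) mT K hs hK c _ hrow (by positivity) (by positivity : 0 ≤ δm / 2) h20 h24 hcomm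
  -- FILE 72
  rw [deltaOp_eq_lapOp_zero_add]
  have h := hasMaj_commOp_comp_cover_of (L := L) (kk := K) (M := M) (n := L ^ K) hM hw hfit hS k hβG.le hβ₁ (by positivity) hcN (by positivity : 0 ≤ δm / 2)
    (le_refl (δm / 2)) h14 h34 hrow hGc hDc hDbc hC hN'
  exact h.mono fun y y' => mul_le_mul_of_nonneg_left (mul_le_mul_of_nonneg_right hΘ (Real.exp_nonneg _)) (ind_nonneg _ _)

/-- ★★★ **THE REMAINDER ROW OF EACH CUBE OF THE COVER ON THE TORUS OF RECORD, FINE SPACING** (`L^r·L^K`, blocks native to the fine spacing): `∃ δ > 0`, `κ₀ ≥ 0` free of the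
volume, the cube exponent, the spacings and the cube index, with `[Δ′_a, M_{h′_k}] ∘ G′^{↑}(□_k) ≤ 1_□(y′)·(κ₀∕L^s)·e^{−δ|y−y′|_T}` for `s + 1 ≤ m_T`, `K ≥ 1` — FILE 72 on
`hasMaj_chiCube_liftCubeG_fine`, §1 `liftCubeG_grad_row_fine`, `hasMaj_chiCube_divAdjOut_liftCubeG_pair` (.2), §1 `liftCubeG_comp_row_fine` with FILE 72 `hasMaj_commOp_coverH` on
FILE 69's nonlocal letter, compressed by `remainderConstR_le`. [cite: Balaban1984PropagatorsII, (2.92)–(2.93) p.239, (2.133)–(2.135) p.247 (shapes + mechanism); Balaban1984PropagatorsI,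
(1.121)–(1.128) pp.37–38] -/
theorem hasMaj_commOp_deltaOp_comp_knitGR_row_fine (hL : Odd L ∧ 1 < L) {a : ℝ} (ha : 0 < a) :
    ∃ δ κ₀ : ℝ, 0 < δ ∧ 0 ≤ κ₀ ∧ ∀ (s mT K r : ℕ) (hs : s + 1 ≤ mT) (_hK : 1 ≤ K) (k : Fin (d + 1) → ZMod (2 * L ^ (mT - s))),
      HasMaj (BlockNorm.ofBlocks (unitTorusGeo L K (MP (paramsOf d L mT K hL)))
          (fun i : Tor (fine (L ^ r * L ^ K) (MP (paramsOf d L mT K hL))) × Fin (d + 1) => blockOf (L ^ r * L ^ K) (MP (paramsOf d L mT K hL)) i.1))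
        (BlockNorm.ofBlocks (unitTorusGeo L K (MP (paramsOf d L mT K hL)))
          (fun i : Tor (fine (L ^ r * L ^ K) (MP (paramsOf d L mT K hL))) × Fin (d + 1) => blockOf (L ^ r * L ^ K) (MP (paramsOf d L mT K hL)) i.1))
        (commOp (deltaOp (MP (paramsOf d L mT K hL)) (L ^ r * L ^ K) a) (knitHR d L s mT K (L ^ r * L ^ K) hL k) ∘ₗ knitGR d L s mT K (L ^ r * L ^ K) hL hs a k)
        (fun y y' => ind ((cubeBlocks (MP (paramsOf d L mT K hL)) (coverCorner (MP (paramsOf d L mT K hL)) (L ^ s) (L ^ (mT - s)) (coverMargin L s) k) (L ^ (s + 1)) : Finset _) : Set _) y' *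
          (κ₀ / ((L ^ s : ℕ) : ℝ) * Real.exp (-(δ * tdistT (MP (paramsOf d L mT K hL)) y y')))) := by
  obtain ⟨δG, βG, hδG, hβG, HG⟩ := hasMaj_chiCube_liftCubeG_fine (d := d) hL ha
  obtain ⟨δD, βD, hδD, hβD, HD⟩ := liftCubeG_grad_row_fine (d := d) hL ha
  obtain ⟨δB, βB, hδB, hβB, HB⟩ := hasMaj_chiCube_divAdjOut_liftCubeG_pair (d := d) hL ha
  obtain ⟨δ₀, C, hδ₀, hC, HC⟩ := liftCubeG_comp_row_fine (d := d) hL ha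
  obtain ⟨δ₁, C₁, hδ₁, hC₁, HL⟩ := hasMaj_landauRe (d := d) (L := L)
  set δm : ℝ := min (min (min δG δD) (min δB δ₀)) δ₁ with hδm_def
  have hδm : 0 < δm := lt_min (lt_min (lt_min hδG hδD) (lt_min hδB hδ₀)) hδ₁
  have hmG : δm ≤ δG := (min_le_left _ _).trans ((min_le_left _ _).trans (min_le_left _ _))
  have hmD : δm ≤ δD := (min_le_left _ _).trans ((min_le_left _ _).trans (min_le_right _ _))
  have hmB : δm ≤ δB := (min_le_left _ _).trans ((min_le_right _ _).trans (min_le_left _ _))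
  have hm0 : δm ≤ δ₀ := (min_le_left _ _).trans ((min_le_right _ _).trans (min_le_right _ _))
  have hm1 : δm ≤ δ₁ := min_le_right _ _
  set cr : ℝ := B4Sect5Proof.latticeConst (d + 1) (δm / 4) with hcr_def
  have hcr : 0 ≤ cr := B4Sect5Proof.latticeConst_nonneg (d + 1) (by positivity)
  set β₁ : ℝ := max βD βB with hβ₁_def
  have hβ₁ : 0 ≤ β₁ := hβD.le.trans (le_max_left _ _)
  set cN : ℝ := |a| * (Real.exp δm * Real.exp δm) + C₁ with hcN_def
  have hcN : 0 ≤ cN := by positivity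
  set κ₀ : ℝ := (((d + 1 : ℕ) * (32 * π ^ 2 * βG + 2 * (π * β₁))) + 2 ^ (d + 1) * ((π * (d + 1) * (Real.exp 1 * (δm / 4))⁻¹ + 2 * (π * (d + 1))) * cN * (C * Real.exp δ₀) * cr) +
    cN * (8 / δm) * βG * cr) with hκ₀_def
  have hκ₀ : 0 ≤ κ₀ := by positivity
  have h14 : δm / 2 + δm / 4 ≤ 3 * δm / 4 := by linarith
  have h34 : 3 * δm / 4 ≤ δm := by linarith
  have h24 : δm / 2 + δm / 4 ≤ δm - δm / 4 := by linarith
  have h20 : δm / 2 ≤ δ₀ := by linarith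
  refine ⟨δm / 2, κ₀, by positivity, hκ₀, fun s mT K r hs hK k => ?_⟩
  have hL3 : 3 ≤ L := by obtain ⟨⟨j, hj⟩, h1⟩ := hL; omega
  have hLpos : 0 < L := by omega
  set M : Fin (d + 1) → ℕ := MP (paramsOf d L mT K hL) with hMdef
  have hs' : s ≤ mT := by omega
  have hM : ∀ ν, M ν = 2 * L ^ (mT - s) * L ^ s := MP_eq_two_mul L s mT K hL hs'
  have hw : 0 < L ^ s := pow_pos hLpos s
  haveI : NeZero (L ^ (mT - s)) := ⟨pow_ne_zero _ (NeZero.ne L)⟩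
  have hwR : (1 : ℝ) ≤ ((L ^ s : ℕ) : ℝ) := by exact_mod_cast hw
  have hSe : L ^ (s + 1) = L * L ^ s := by rw [pow_succ, mul_comm]
  have hfit : 2 * coverMargin L s + 2 * L ^ s + 1 ≤ L ^ (s + 1) := by rw [hSe]; exact coverMargin_fit hL3 s
  have hS : L ^ (s + 1) ≤ 2 * L ^ (mT - s) * L ^ s := by
    rw [← hM 0]
    show L ^ (s + 1) ≤ 2 * L ^ mT
    have := Nat.pow_le_pow_right hLpos hs
    omega
  have hwm : ((L ^ s : ℕ) : ℝ) ≤ 2 * ((coverMargin L s : ℝ) + 1) := by exact_mod_cast le_two_mul_coverMargin hL3 s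
  have hΘ := remainderConstR_le d (β₁ := β₁) (m₀ := ((coverMargin L s : ℕ) : ℝ)) (CC := C * Real.exp δ₀) hβG.le hcN hδm hcr hwR hwm
  have hrow := rowSum_unitTorusGeo (L := L) (k := K) (M := M) (σ := δm / 4) (by positivity)
  set c : Tor M := coverCorner M (L ^ s) (L ^ (mT - s)) (coverMargin L s) k with hc_def
  have hind : ∀ y y' : Tor M, 0 ≤ ind (g := unitTorusGeo L K M) ((cubeBlocks M c (L ^ (s + 1)) : Finset (Tor M)) : Set (Tor M)) y *
      ind (g := unitTorusGeo L K M) ((cubeBlocks M c (L ^ (s + 1)) : Finset (Tor M)) : Set (Tor M)) y' := fun y y' => mul_nonneg (ind_nonneg _ _) (ind_nonneg _ _)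
  -- the nonlocal part's letter, the cut rows and the commutator half at the common rate `δm ∕ 2` (fine spacing)
  have hN' := hasMaj_nonlocalPart (L := L) (kk := K) (M := M) (n := L ^ r * L ^ K) (a := a) hC₁.le hδm.le hm1 (HL K (L ^ r * L ^ K) M)
  have hGc : HasMaj (BlockNorm.ofBlocks (unitTorusGeo L K M) (fun i : Tor (fine (L ^ r * L ^ K) M) × Fin (d + 1) => blockOf (L ^ r * L ^ K) M i.1))
      (BlockNorm.ofBlocks (unitTorusGeo L K M) (fun i : Tor (fine (L ^ r * L ^ K) M) × Fin (d + 1) => blockOf (L ^ r * L ^ K) M i.1))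
      (mulOp (chiCube M (L ^ r * L ^ K) c (L ^ (s + 1))) ∘ₗ knitGR d L s mT K (L ^ r * L ^ K) hL hs a k)
      (fun y y' => ind ((cubeBlocks M c (L ^ (s + 1)) : Finset (Tor M)) : Set (Tor M)) y * ind ((cubeBlocks M c (L ^ (s + 1)) : Finset (Tor M)) : Set (Tor M)) y' *
        (βG * Real.exp (-(δm / 2 * tdistT M y y')))) := hasMaj_rate_le hind hβG.le (by linarith) (HG (s + 1) mT K r hs hK c)
  have hDc : ∀ μ, HasMaj (BlockNorm.ofBlocks (unitTorusGeo L K M) (fun i : Tor (fine (L ^ r * L ^ K) M) × Fin (d + 1) => blockOf (L ^ r * L ^ K) M i.1))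
      (BlockNorm.ofBlocks (unitTorusGeo L K M) (fun i : Tor (fine (L ^ r * L ^ K) M) × Fin (d + 1) => blockOf (L ^ r * L ^ K) M i.1))
      (mulOp (chiCube M (L ^ r * L ^ K) c (L ^ (s + 1))) ∘ₗ (fgrad ((L ^ r * L ^ K : ℕ) : ℝ) (bshiftEquiv M (L ^ r * L ^ K) μ) ∘ₗ knitGR d L s mT K (L ^ r * L ^ K) hL hs a k))
      (fun y y' => ind ((cubeBlocks M c (L ^ (s + 1)) : Finset (Tor M)) : Set (Tor M)) y * ind ((cubeBlocks M c (L ^ (s + 1)) : Finset (Tor M)) : Set (Tor M)) y' *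
        (β₁ * Real.exp (-(δm / 2 * tdistT M y y')))) := fun μ => by
    rw [← symbOp_sD_eq]
    exact (hasMaj_rate_le hind hβD.le (by linarith : δm / 2 ≤ δD) (HD (s + 1) mT K r hs hK c μ)).mono fun y y' =>
      mul_le_mul_of_nonneg_left (mul_le_mul_of_nonneg_right (le_max_left _ _) (Real.exp_nonneg _)) (hind y y')
  have hDbc : ∀ μ, HasMaj (BlockNorm.ofBlocks (unitTorusGeo L K M) (fun i : Tor (fine (L ^ r * L ^ K) M) × Fin (d + 1) => blockOf (L ^ r * L ^ K) M i.1))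
      (BlockNorm.ofBlocks (unitTorusGeo L K M) (fun i : Tor (fine (L ^ r * L ^ K) M) × Fin (d + 1) => blockOf (L ^ r * L ^ K) M i.1))
      (mulOp (chiCube M (L ^ r * L ^ K) c (L ^ (s + 1))) ∘ₗ (bgrad ((L ^ r * L ^ K : ℕ) : ℝ) (bshiftEquiv M (L ^ r * L ^ K) μ) ∘ₗ knitGR d L s mT K (L ^ r * L ^ K) hL hs a k))
      (fun y y' => ind ((cubeBlocks M c (L ^ (s + 1)) : Finset (Tor M)) : Set (Tor M)) y * ind ((cubeBlocks M c (L ^ (s + 1)) : Finset (Tor M)) : Set (Tor M)) y' *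
        (β₁ * Real.exp (-(δm / 2 * tdistT M y y')))) := fun μ => by
    rw [bgrad_eq_neg_symbOp, LinearMap.neg_comp, LinearMap.comp_neg]
    exact ((hasMaj_rate_le hind hβB.le (by linarith : δm / 2 ≤ δB) ((HB (s + 1) mT K r hs hK c μ).2)).mono fun y y' =>
      mul_le_mul_of_nonneg_left (mul_le_mul_of_nonneg_right (le_max_right _ _) (Real.exp_nonneg _)) (hind y y')).neg
  have hcomm := hasMaj_commOp_coverH (L := L) (kk := K) (M := M) (n := L ^ r * L ^ K) (w := L ^ s) (q := L ^ (mT - s)) hM hw k hcN (by positivity : 0 < δm / 4) hN'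
  have hC := HC (s + 1) mT K r hs hK c _ hrow (by positivity) (by positivity : 0 ≤ δm / 2) h20 h24 hcomm
  -- FILE 72 at the fine spacing
  rw [deltaOp_eq_lapOp_zero_add]
  have h := hasMaj_commOp_comp_cover_of (L := L) (kk := K) (M := M) (n := L ^ r * L ^ K) hM hw hfit hS k hβG.le hβ₁ (by positivity) hcN (by positivity : 0 ≤ δm / 2)
    (le_refl (δm / 2)) h14 h34 hrow hGc hDc hDbc hC hN'
  exact h.mono fun y y' => mul_le_mul_of_nonneg_left (mul_le_mul_of_nonneg_right hΘ (Real.exp_nonneg _)) (ind_nonneg _ _)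

end RemainderRows

end Summit.QuantumFields.YangMills.BalabanUVNodes.N15.Gluing

end
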